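import Mathlib
import Literature.Analysis.FluidPDE.NormalisedPressureCompactSupport
import Literature.Analysis.FluidPDE.LocalPressureFarFieldTools
import HarnessLib

/-!
# Slice pressure, far field (crux `FarPastLedger`, line `uloc-gronwall-transplant`)

Helper file for the lead's stub `stub_fplSlicePressure` of crux stmt-NavierStokesRegularity-14060
(`SymmetryModuliCount.FarPastLedger`): the normalised (Riesz) pressure `p̃[v]` of a smooth
compactly supported field `v` vanishing on `B(x₀, 3R)`, evaluated on `B(x₀, 2R)`, `R ≥ 1`.

* `fpl_normalisedPressure_eq_neg_farPotential` — there `p̃[v] = -Q∞[v]`, the far potential of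
  the tree (`farPotential (R/2) R`, kernel `D²Γ∞ = D²Γ` off `B̄(0,R)`), because the principal
  value is an honest integral off the support (`normalisedPressure_eq_truncated_of_vanish`);
* `fpl_hasFDerivAt_normalisedPressure_far` — hence `p̃[v]` is differentiable there with
  `Dp̃[v](x) = -∫ D³Γ∞(x - y)(·, v y, v y) dy`;
* `fpl_norm_farGradient_le` — `‖∫ D³Γ∞(x - y)(·, u y, u y) dy‖ ≤ C_K ∫ ‖u y‖² ‖y - x₀‖⁻⁴ dy` for
  every bounded continuous `u` vanishing on `B(x₀,3R)` (`‖D³Γ(z)‖ ≤ M|z|⁻⁴` and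
  `|x - y| ≥ |y - x₀|/3`), with the integrability of the weight `‖u‖²‖y - x₀‖⁻⁴`;
* `fpl_tendsto_farGradient` — dominated convergence for truncations `c_ρ² u ⊗ u`, `|c_ρ| ≤ 1`,
  `c_ρ → 1` pointwise-eventually.
-/

noncomputable section

open MeasureTheory Set Filter Metric Topology
open scoped ContDiff

set_option linter.dupNamespace false -- nested layout Summit.<S>.<Sub>, Sub = S (D-0017)

namespace Summit.NavierStokesRegularity.NavierStokesRegularity.Theorems

open Literature.Analysis.FluidPDE

-- nested operator types `E →L[ℝ] E →L[ℝ] E →L[ℝ] ℝ`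
set_option maxSynthPendingDepth 3

/-! ### `Γ∞ = Γ` off the cut-off ball, with derivatives -/

/-- `Γ∞` and `Γ` agree near every point with `‖z‖ > r₁`. -/
theorem fpl_newtonFar_eventuallyEq {r₀ r₁ : ℝ} (h₀ : 0 ≤ r₀) (h₁ : r₀ < r₁) {z : (EuclideanSpace ℝ (Fin 3))}
    (hz : r₁ < ‖z‖) : newtonFar r₀ r₁ =ᶠ[𝓝 z] newtonKernel := by
  have hopen : IsOpen {w : (EuclideanSpace ℝ (Fin 3)) | r₁ < ‖w‖} := isOpen_lt continuous_const continuous_norm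
  filter_upwards [hopen.mem_nhds hz] with w hw
  exact newtonFar_eq_newtonKernel h₀ h₁ (le_of_lt hw)

/-- `D²Γ∞ = D²Γ` at points with `‖z‖ > r₁`. -/
theorem fpl_fderiv2_newtonFar_eq {r₀ r₁ : ℝ} (h₀ : 0 ≤ r₀) (h₁ : r₀ < r₁) {z : (EuclideanSpace ℝ (Fin 3))}
    (hz : r₁ < ‖z‖) :
    fderiv ℝ (fderiv ℝ (newtonFar r₀ r₁)) z = fderiv ℝ (fderiv ℝ newtonKernel) z :=
  (fpl_newtonFar_eventuallyEq h₀ h₁ hz).fderiv.fderiv_eq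

/-- `D³Γ∞ = D³Γ` at points with `‖z‖ > r₁`. -/
theorem fpl_fderiv3_newtonFar_eq {r₀ r₁ : ℝ} (h₀ : 0 ≤ r₀) (h₁ : r₀ < r₁) {z : (EuclideanSpace ℝ (Fin 3))}
    (hz : r₁ < ‖z‖) :
    fderiv ℝ (fderiv ℝ (fderiv ℝ (newtonFar r₀ r₁))) z =
      fderiv ℝ (fderiv ℝ (fderiv ℝ newtonKernel)) z :=
  (fpl_newtonFar_eventuallyEq h₀ h₁ hz).fderiv.fderiv.fderiv_eq

/-! ### `p̃[v] = -Q∞[v]` off the support -/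

/-- If `v` vanishes on `B̄(x, r₁)` then `K(x-y)(v y) = -D²Γ∞(x-y)(v y, v y)` for every `y`. -/
theorem fpl_pressureKernel_eq_neg_fderiv2_newtonFar {r₀ r₁ : ℝ} (h₀ : 0 ≤ r₀) (h₁ : r₀ < r₁)
    {v : (EuclideanSpace ℝ (Fin 3)) → (EuclideanSpace ℝ (Fin 3))} {x : (EuclideanSpace ℝ (Fin 3))} (h0 : ∀ y ∈ closedBall x r₁, v y = 0) (y : (EuclideanSpace ℝ (Fin 3))) :
    pressureKernel (x - y) (v y) = -fderiv ℝ (fderiv ℝ (newtonFar r₀ r₁)) (x - y) (v y) (v y) := by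
  by_cases hy : y ∈ closedBall x r₁
  · rw [h0 y hy]
    simp
  · have hxy : r₁ < ‖x - y‖ := by
      rw [mem_closedBall, dist_eq_norm, norm_sub_rev] at hy
      exact lt_of_not_ge hy
    have hne : x - y ≠ 0 := norm_pos_iff.1 (lt_of_le_of_lt (h₀.trans h₁.le) hxy)
    rw [pressureKernel_eq_neg_fderiv2 hne, fpl_fderiv2_newtonFar_eq h₀ h₁ hxy]

/-- **`p̃[v](x) = -Q∞[v](x)`** for `v ∈ C_c^∞` vanishing on `B̄(x, r₁)`, `1 ≤ r₁`
(`Q∞ = farPotential r₀ r₁`). -/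
theorem fpl_normalisedPressure_eq_neg_farPotential {r₀ r₁ : ℝ} (h₀ : 0 < r₀) (h₁ : r₀ < r₁)
    (hr₁ : 1 ≤ r₁) {v : (EuclideanSpace ℝ (Fin 3)) → (EuclideanSpace ℝ (Fin 3))} (hv : ContDiff ℝ ∞ v) (hvc : HasCompactSupport v) {x : (EuclideanSpace ℝ (Fin 3))}
    (h0 : ∀ y ∈ closedBall x r₁, v y = 0) :
    normalisedPressure v x = -farPotential r₀ r₁ v x := by
  rw [normalisedPressure_eq_truncated_of_vanish hv hvc hr₁ h0, truncatedPressureIntegral,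
    setIntegral_eq_integral_of_forall_compl_eq_zero (fun y hy => ?_)]
  · rw [farPotential, ← integral_neg]
    exact integral_congr_ae (Eventually.of_forall fun y =>
      fpl_pressureKernel_eq_neg_fderiv2_newtonFar h₀.le h₁ h0 y)
  · have hy' : y ∈ closedBall x r₁ := Set.notMem_compl_iff.1 hy
    rw [h0 y hy', pressureKernel_zero_right]

/-! ### Differentiability of the far field -/

/-- `Q∞[v]` is differentiable with `DQ∞[v](x) = ∫ D³Γ∞(x - y)(·, v y, v y) dy`, for `v`
continuous with compact support. -/
theorem fpl_hasFDerivAt_farPotential {r₀ r₁ : ℝ} (h₀ : 0 < r₀) (h₁ : r₀ < r₁) {v : (EuclideanSpace ℝ (Fin 3)) → (EuclideanSpace ℝ (Fin 3))}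
    (hv : Continuous v) (hvc : HasCompactSupport v) (x : (EuclideanSpace ℝ (Fin 3))) :
    HasFDerivAt (farPotential r₀ r₁ v)
      (∫ y, (evalDiag (v y)).comp (fderiv ℝ (fderiv ℝ (fderiv ℝ (newtonFar r₀ r₁))) (x - y))) x := by
  obtain ⟨M₀, M₁, M₂, hM₀, hM₁, -⟩ := exists_bounds_fderiv2_newtonFar h₀ h₁
  have hΦ : ContDiff ℝ 1 (fderiv ℝ (fderiv ℝ (newtonFar r₀ r₁))) :=
    (contDiff_fderiv2_newtonFar h₀ h₁).of_le (by norm_num)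
  have hL2 : Integrable (fun y => ‖v y‖ ^ 2) := integrable_norm_sq_of_hasCompactSupport hv hvc
  have key := hasFDerivAt_integral_clm_apply_comp_sub (L := fun y => evalDiag (v y)) hΦ hM₀ hM₁
    (continuous_evalDiag.comp hv) (integrable_evalDiag_comp hv hL2) x
  rw [farPotential_eq]
  exact key

/-- Geometry: for `x ∈ B(x₀, 2R)` the closed ball `B̄(x, R)` lies in `B(x₀, 3R)`. -/
theorem fpl_closedBall_subset_ball {x₀ x : (EuclideanSpace ℝ (Fin 3))} {R : ℝ} (hx : x ∈ ball x₀ (2 * R)) :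
    closedBall x R ⊆ ball x₀ (3 * R) := by
  intro y hy
  rw [mem_closedBall] at hy
  rw [mem_ball] at hx ⊢
  calc dist y x₀ ≤ dist y x + dist x x₀ := dist_triangle _ _ _
    _ < R + 2 * R := add_lt_add_of_le_of_lt hy hx
    _ = 3 * R := by ring

/-- **Differentiability of `p̃[v]` on `B(x₀, 2R)`** for `v ∈ C_c^∞` vanishing on `B(x₀, 3R)`,
`R ≥ 1`, with derivative `-∫ D³Γ∞(x - y)(·, v y, v y) dy` (`Γ∞ = newtonFar (R/2) R`). -/
theorem fpl_hasFDerivAt_normalisedPressure_far {R : ℝ} (hR : 1 ≤ R) {v : (EuclideanSpace ℝ (Fin 3)) → (EuclideanSpace ℝ (Fin 3))}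
    (hv : ContDiff ℝ ∞ v) (hvc : HasCompactSupport v) {x₀ : (EuclideanSpace ℝ (Fin 3))}
    (h0 : ∀ y ∈ ball x₀ (3 * R), v y = 0) {x : (EuclideanSpace ℝ (Fin 3))} (hx : x ∈ ball x₀ (2 * R)) :
    HasFDerivAt (normalisedPressure v)
      (-∫ y, (evalDiag (v y)).comp (fderiv ℝ (fderiv ℝ (fderiv ℝ (newtonFar (R / 2) R))) (x - y))) x := by
  have hR0 : 0 < R / 2 := by linarith
  have hR1 : R / 2 < R := by linarith
  have hev : normalisedPressure v =ᶠ[𝓝 x] fun x' => -farPotential (R / 2) R v x' := by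
    filter_upwards [isOpen_ball.mem_nhds hx] with x' hx'
    exact fpl_normalisedPressure_eq_neg_farPotential hR0 hR1 hR hv hvc
      (fun y hy => h0 y (fpl_closedBall_subset_ball hx' hy))
  exact ((fpl_hasFDerivAt_farPotential hR0 hR1 hv.continuous hvc x).neg).congr_of_eventuallyEq hev

/-! ### Bounds for the far gradient kernel -/

/-- **The kernel bound**: there is `C_K ≥ 0` with `‖D³Γ∞(x - y)‖ ≤ C_K ‖y - x₀‖⁻⁴` whenever
`x ∈ B(x₀, 2R)`, `y ∉ B(x₀, 3R)`, `R > 0` (`Γ∞ = newtonFar (R/2) R`; there `Γ∞ = Γ`,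
`‖D³Γ(z)‖ ≤ M|z|⁻⁴` and `|x - y| ≥ |y - x₀|/3`). -/
theorem fpl_exists_kernel_bound :
    ∃ C_K : ℝ, 0 ≤ C_K ∧ ∀ (R : ℝ), 0 < R → ∀ (x₀ x y : (EuclideanSpace ℝ (Fin 3))), x ∈ ball x₀ (2 * R) →
      y ∉ ball x₀ (3 * R) →
      ‖fderiv ℝ (fderiv ℝ (fderiv ℝ (newtonFar (R / 2) R))) (x - y)‖ ≤ C_K / ‖y - x₀‖ ^ 4 := by
  obtain ⟨M, hM0, hM⟩ := exists_norm_fderiv3_newtonKernel_le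
  refine ⟨81 * M, by positivity, fun R hR x₀ x y hx hy => ?_⟩
  rw [mem_ball] at hx
  rw [mem_ball, not_lt] at hy
  have hyx₀ : 0 < dist y x₀ := lt_of_lt_of_le (by linarith) hy
  -- `|x - y| > R` and `|y - x₀| ≤ 3 |x - y|`
  have h3 : dist y x₀ < 3 * ‖x - y‖ := by
    have := dist_triangle y x x₀
    rw [dist_eq_norm y x, norm_sub_rev] at this
    nlinarith
  have hxy : R < ‖x - y‖ := by nlinarith
  have hne : x - y ≠ 0 := norm_pos_iff.1 (hR.trans hxy)
  rw [fpl_fderiv3_newtonFar_eq (by linarith) (by linarith) hxy]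
  refine (hM _ hne).trans ?_
  rw [dist_eq_norm] at hyx₀ h3
  have hxy0 : 0 < ‖x - y‖ := hR.trans hxy
  rw [div_le_div_iff₀ (pow_pos hxy0 4) (pow_pos hyx₀ 4)]
  have h4 : ‖y - x₀‖ ^ 4 ≤ (3 * ‖x - y‖) ^ 4 :=
    pow_le_pow_left₀ (norm_nonneg _) h3.le 4
  nlinarith [pow_pos hxy0 4]

/-- **Integrability of the far weight** `‖u‖² ‖y - x₀‖⁻⁴` for a bounded a.e.-strongly measurable
`u` vanishing on `B(x₀, 3R)`, `R ≥ 1` (comparison with `(1 + |y - x₀|)⁻⁴ ∈ L¹((EuclideanSpace ℝ (Fin 3)))`). -/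
theorem fpl_integrable_far_weight {u : (EuclideanSpace ℝ (Fin 3)) → (EuclideanSpace ℝ (Fin 3))} (hu : AEStronglyMeasurable u volume) {M : ℝ}
    (hM : ∀ y, ‖u y‖ ≤ M) {x₀ : (EuclideanSpace ℝ (Fin 3))} {R : ℝ} (hR : 1 ≤ R) (h0 : ∀ y ∈ ball x₀ (3 * R), u y = 0) :
    Integrable (fun y => ‖u y‖ ^ 2 / ‖y - x₀‖ ^ 4) volume := by
  -- the majorant `M² (4/3)⁴ (1 + ‖y - x₀‖)^{-4}`
  have hJ : Integrable (fun y : (EuclideanSpace ℝ (Fin 3)) => (1 + ‖y - x₀‖) ^ (-(4 : ℝ))) volume := by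
    have h := (integrable_one_add_norm (E := (EuclideanSpace ℝ (Fin 3))) (μ := volume) (r := 4)
      (by rw [finrank_euclideanSpace_fin]; norm_num))
    exact h.comp_sub_right x₀
  refine Integrable.mono' (hJ.const_mul (M ^ 2 * (4 / 3) ^ 4)) ?_ (Eventually.of_forall fun y => ?_)
  · have h1 : AEMeasurable (fun y => ‖u y‖ ^ 2) volume := hu.norm.aemeasurable.pow_const 2
    have h2 : Measurable (fun y : (EuclideanSpace ℝ (Fin 3)) => ‖y - x₀‖ ^ 4) := by fun_prop
    exact (h1.div h2.aemeasurable).aestronglyMeasurable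
  rw [Real.norm_eq_abs, abs_of_nonneg (by positivity)]
  by_cases hy : y ∈ ball x₀ (3 * R)
  · rw [h0 y hy, norm_zero, zero_pow two_ne_zero, zero_div]
    exact mul_nonneg (by positivity) (Real.rpow_nonneg (by positivity) _)
  · rw [mem_ball, not_lt, dist_eq_norm] at hy
    have hy3 : 3 ≤ ‖y - x₀‖ := le_trans (by linarith) hy
    have hpos : 0 < ‖y - x₀‖ := by linarith
    have h1 : 1 + ‖y - x₀‖ ≤ (4 / 3) * ‖y - x₀‖ := by linarith
    have hrpow : (1 + ‖y - x₀‖) ^ (-(4 : ℝ)) = ((1 + ‖y - x₀‖) ^ 4)⁻¹ := by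
      rw [Real.rpow_neg (by positivity), show (4 : ℝ) = ((4 : ℕ) : ℝ) by norm_num,
        Real.rpow_natCast]
    rw [hrpow]
    have hM' : ‖u y‖ ^ 2 ≤ M ^ 2 := by
      have := hM y
      have h0' : 0 ≤ ‖u y‖ := norm_nonneg _
      nlinarith
    have key : (1 : ℝ) / ‖y - x₀‖ ^ 4 ≤ (4 / 3) ^ 4 * ((1 + ‖y - x₀‖) ^ 4)⁻¹ := by
      rw [← one_div, ← div_eq_mul_one_div, div_le_div_iff₀ (pow_pos hpos 4) (by positivity)]
      have := pow_le_pow_left₀ (by positivity) h1 4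
      nlinarith
    calc ‖u y‖ ^ 2 / ‖y - x₀‖ ^ 4 = ‖u y‖ ^ 2 * (1 / ‖y - x₀‖ ^ 4) := by ring
      _ ≤ M ^ 2 * ((4 / 3) ^ 4 * ((1 + ‖y - x₀‖) ^ 4)⁻¹) :=
          mul_le_mul hM' key (by positivity) (sq_nonneg M)
      _ = M ^ 2 * (4 / 3) ^ 4 * ((1 + ‖y - x₀‖) ^ 4)⁻¹ := by ring

/-- **The far gradient bound**: with `C_K` of `fpl_exists_kernel_bound`, for `R ≥ 1`, `u` continuous,
bounded, vanishing on `B(x₀, 3R)`, and `x ∈ B(x₀, 2R)`,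
`‖∫ D³Γ∞(x - y)(·, u y, u y) dy‖ ≤ C_K ∫ ‖u y‖² ‖y - x₀‖⁻⁴ dy`, and the integrand is dominated by the
integrable `C_K ‖u‖² ‖y - x₀‖⁻⁴`. -/
theorem fpl_norm_farGradient_le {C_K : ℝ}
    (hC : ∀ (R : ℝ), 0 < R → ∀ (x₀ x y : (EuclideanSpace ℝ (Fin 3))), x ∈ ball x₀ (2 * R) → y ∉ ball x₀ (3 * R) →
      ‖fderiv ℝ (fderiv ℝ (fderiv ℝ (newtonFar (R / 2) R))) (x - y)‖ ≤ C_K / ‖y - x₀‖ ^ 4)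
    {R : ℝ} (hR : 1 ≤ R) {u : (EuclideanSpace ℝ (Fin 3)) → (EuclideanSpace ℝ (Fin 3))} (hu : Continuous u) {M : ℝ} (hM : ∀ y, ‖u y‖ ≤ M)
    {x₀ : (EuclideanSpace ℝ (Fin 3))} (h0 : ∀ y ∈ ball x₀ (3 * R), u y = 0) {x : (EuclideanSpace ℝ (Fin 3))} (hx : x ∈ ball x₀ (2 * R)) :
    (∀ y, ‖(evalDiag (u y)).comp (fderiv ℝ (fderiv ℝ (fderiv ℝ (newtonFar (R / 2) R))) (x - y))‖ ≤
        C_K * (‖u y‖ ^ 2 / ‖y - x₀‖ ^ 4)) ∧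
      ‖∫ y, (evalDiag (u y)).comp (fderiv ℝ (fderiv ℝ (fderiv ℝ (newtonFar (R / 2) R))) (x - y))‖ ≤
        C_K * ∫ y, ‖u y‖ ^ 2 / ‖y - x₀‖ ^ 4 := by
  have hpt : ∀ y, ‖(evalDiag (u y)).comp
      (fderiv ℝ (fderiv ℝ (fderiv ℝ (newtonFar (R / 2) R))) (x - y))‖ ≤
      C_K * (‖u y‖ ^ 2 / ‖y - x₀‖ ^ 4) := by
    intro y
    by_cases hy : y ∈ ball x₀ (3 * R)
    · rw [h0 y hy]
      have : evalDiag (0 : (EuclideanSpace ℝ (Fin 3))) = 0 := by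
        ext B; simp
      rw [this, ContinuousLinearMap.zero_comp, norm_zero, norm_zero, zero_pow two_ne_zero, zero_div,
        mul_zero]
    · calc ‖(evalDiag (u y)).comp (fderiv ℝ (fderiv ℝ (fderiv ℝ (newtonFar (R / 2) R))) (x - y))‖
          ≤ ‖evalDiag (u y)‖ * ‖fderiv ℝ (fderiv ℝ (fderiv ℝ (newtonFar (R / 2) R))) (x - y)‖ :=
            ContinuousLinearMap.opNorm_comp_le _ _
        _ ≤ ‖u y‖ ^ 2 * (C_K / ‖y - x₀‖ ^ 4) :=
            mul_le_mul (norm_evalDiag_le _) (hC R (by linarith) x₀ x y hx hy) (norm_nonneg _)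
              (sq_nonneg _)
        _ = C_K * (‖u y‖ ^ 2 / ‖y - x₀‖ ^ 4) := by ring
  refine ⟨hpt, ?_⟩
  have hint : Integrable (fun y => C_K * (‖u y‖ ^ 2 / ‖y - x₀‖ ^ 4)) volume :=
    (fpl_integrable_far_weight hu.aestronglyMeasurable hM hR h0).const_mul C_K
  calc ‖∫ y, (evalDiag (u y)).comp (fderiv ℝ (fderiv ℝ (fderiv ℝ (newtonFar (R / 2) R))) (x - y))‖
      ≤ ∫ y, C_K * (‖u y‖ ^ 2 / ‖y - x₀‖ ^ 4) :=
        norm_integral_le_of_norm_le hint (Eventually.of_forall hpt)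
    _ = C_K * ∫ y, ‖u y‖ ^ 2 / ‖y - x₀‖ ^ 4 := integral_const_mul _ _

/-- `evalDiag (c • a) = c² • evalDiag a`. -/
theorem fpl_evalDiag_smul (c : ℝ) (a : (EuclideanSpace ℝ (Fin 3))) : evalDiag (c • a) = c ^ 2 • evalDiag a := by
  ext B
  simp only [evalDiag_apply, map_smul, FunLike.coe_smul, Pi.smul_apply, smul_eq_mul]
  ring

/-- **Dominated convergence for truncated far fields**: if `|c ρ y| ≤ 1` and `c ρ y = 1`
eventually as `ρ → ∞` for every `y`, then
`∫ D³Γ∞(x - y)(·, c_ρ u, c_ρ u) dy → ∫ D³Γ∞(x - y)(·, u y, u y) dy`. -/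
theorem fpl_tendsto_farGradient {C_K : ℝ}
    (hC : ∀ (R : ℝ), 0 < R → ∀ (x₀ x y : (EuclideanSpace ℝ (Fin 3))), x ∈ ball x₀ (2 * R) → y ∉ ball x₀ (3 * R) →
      ‖fderiv ℝ (fderiv ℝ (fderiv ℝ (newtonFar (R / 2) R))) (x - y)‖ ≤ C_K / ‖y - x₀‖ ^ 4)
    {R : ℝ} (hR : 1 ≤ R) {u : (EuclideanSpace ℝ (Fin 3)) → (EuclideanSpace ℝ (Fin 3))} (hu : Continuous u) {M : ℝ} (hM : ∀ y, ‖u y‖ ≤ M)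
    {x₀ : (EuclideanSpace ℝ (Fin 3))} (h0 : ∀ y ∈ ball x₀ (3 * R), u y = 0) {x : (EuclideanSpace ℝ (Fin 3))} (hx : x ∈ ball x₀ (2 * R))
    {c : ℝ → (EuclideanSpace ℝ (Fin 3)) → ℝ} (hcm : ∀ ρ, Continuous (c ρ)) (hc1 : ∀ ρ y, |c ρ y| ≤ 1)
    (hclim : ∀ y, ∀ᶠ ρ in atTop, c ρ y = 1) :
    Tendsto (fun ρ => ∫ y, (evalDiag (c ρ y • u y)).comp
        (fderiv ℝ (fderiv ℝ (fderiv ℝ (newtonFar (R / 2) R))) (x - y))) atTop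
      (𝓝 (∫ y, (evalDiag (u y)).comp (fderiv ℝ (fderiv ℝ (fderiv ℝ (newtonFar (R / 2) R))) (x - y)))) := by
  set T : (EuclideanSpace ℝ (Fin 3)) → ((EuclideanSpace ℝ (Fin 3)) →L[ℝ] ℝ) := fun y =>
    (evalDiag (u y)).comp (fderiv ℝ (fderiv ℝ (fderiv ℝ (newtonFar (R / 2) R))) (x - y)) with hT
  have hpt := (fpl_norm_farGradient_le hC hR hu hM h0 hx).1
  have hΦc : Continuous (fderiv ℝ (fderiv ℝ (fderiv ℝ (newtonFar (R / 2) R)))) :=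
    ((contDiff_fderiv2_newtonFar (by linarith) (by linarith)).continuous_fderiv (by norm_num))
  have hTm : AEStronglyMeasurable T volume := by
    refine Continuous.aestronglyMeasurable ?_
    exact ((continuous_evalDiag.comp hu)).clm_comp (hΦc.comp (continuous_const.sub continuous_id))
  refine tendsto_integral_filter_of_dominated_convergence
    (bound := fun y => C_K * (‖u y‖ ^ 2 / ‖y - x₀‖ ^ 4)) ?_ ?_ ?_ ?_
  · refine Eventually.of_forall fun ρ => ?_
    have : (fun y => (evalDiag (c ρ y • u y)).comp
        (fderiv ℝ (fderiv ℝ (fderiv ℝ (newtonFar (R / 2) R))) (x - y))) = fun y => (c ρ y) ^ 2 • T y := by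
      funext y
      rw [fpl_evalDiag_smul, ContinuousLinearMap.smul_comp]
    rw [this]
    exact ((hcm ρ).pow 2).aestronglyMeasurable.smul hTm
  · refine Eventually.of_forall fun ρ => Eventually.of_forall fun y => ?_
    rw [fpl_evalDiag_smul, ContinuousLinearMap.smul_comp, norm_smul, Real.norm_eq_abs, abs_pow]
    calc |c ρ y| ^ 2 * ‖T y‖ ≤ 1 * ‖T y‖ := by
          refine mul_le_mul_of_nonneg_right ?_ (norm_nonneg _)
          have := hc1 ρ y
          have h0' : 0 ≤ |c ρ y| := abs_nonneg _
          nlinarith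
      _ = ‖T y‖ := one_mul _
      _ ≤ C_K * (‖u y‖ ^ 2 / ‖y - x₀‖ ^ 4) := hpt y
  · exact (fpl_integrable_far_weight hu.aestronglyMeasurable hM hR h0).const_mul C_K
  · refine Eventually.of_forall fun y => ?_
    have hev : (fun ρ => (evalDiag (c ρ y • u y)).comp
        (fderiv ℝ (fderiv ℝ (fderiv ℝ (newtonFar (R / 2) R))) (x - y))) =ᶠ[atTop] fun _ => T y := by
      filter_upwards [hclim y] with ρ hρ
      rw [hρ, one_smul]
    exact (tendsto_congr' hev).2 tendsto_const_nhds

/-- Registered form (sub-goal `fpl_sliceFar_main` of crux stmt-NavierStokesRegularity-14060): the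
far pressure is differentiable on `B(x₀, 2R)` with the `D³Γ∞` representation of its derivative. -/
theorem fpl_sliceFar_main :
    ∀ (R : ℝ), 1 ≤ R → ∀ (v : EuclideanSpace ℝ (Fin 3) → EuclideanSpace ℝ (Fin 3)),
    ContDiff ℝ (⊤ : ℕ∞) v → HasCompactSupport v → ∀ (x₀ : EuclideanSpace ℝ (Fin 3)),
    (∀ y ∈ Metric.ball x₀ (3 * R), v y = 0) → ∀ x ∈ Metric.ball x₀ (2 * R),
    HasFDerivAt (Literature.Analysis.FluidPDE.normalisedPressure v)
      (-∫ y, (Literature.Analysis.FluidPDE.evalDiag (v y)).comp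
        (fderiv ℝ (fderiv ℝ (fderiv ℝ (Literature.Analysis.FluidPDE.newtonFar (R / 2) R))) (x - y))) x :=
  fun _ hR _ hv hvc _ h0 _ hx => fpl_hasFDerivAt_normalisedPressure_far hR hv hvc h0 hx

end Summit.NavierStokesRegularity.NavierStokesRegularity.Theorems

end
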